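/-
Copyright: statement-level skeleton of a published paper (lit-balaban cell, Phase-2 proof seat p40 gen 71). No proof claims
beyond what the kernel checks below.
-/
import Literature.MathematicalPhysics.QuantumFieldTheory.Balaban1983to89.B3Ineq314ZeroLattice
import Literature.MathematicalPhysics.QuantumFieldTheory.Balaban1983to89.B3Eq322PositiveDegree

/-!
# B3 — T. Bałaban, *(Higgs)₂,₃ quantum fields in a finite volume. III. Renormalization*, CMP **88** (1983) 411–445
[Balaban1983Higgs3], pp. 438–439 [PDF 28–29]: the two-scalar-leg graphs WITH ONE LEG DIFFERENTIATED **(3.21)**, the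
transformation **(3.22)** and the resummed local vertex **(3.23)** ON THE PRINT'S OWN CARRIER `ηℤ^{d+1}` — the expressions WITH
BODIES on the infinite lattice, (3.22) PROVED as the identity it is, the chain (3.22) → (3.23) PROVED, *"The first graph on the right
side has positive degree"* PROVED quantitatively, and the kernel hypotheses DISCHARGED for the (2.6)-pieces of the §3 propagator
`G_k(0) = G_k(ηℤ^{d+1}, 0)`

statement-level skeleton of published theorems with citation tags; proofs where landed; nothing here is a claim about
the Yang–Mills mass gap

PDF held: `paper:balaban1983-higgs-2-3-quantum-fields-finite-volume` (journal page = PDF page + 410); pp. 438–439 [PDF 28–29] read in the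
OCR text (`p0028.txt`, `p0029.txt` of `lit read`) and, for the pictures (3.21)/(3.22) and the display (3.23), on the ×2 render
`run/shared/lean/pub/pub-balaban/b2b-balaban-ref1/pages/1983-cmp88-higgs23-III/1983-cmp88-higgs23-III-p029-x2.png`.

CITATION HEADER (lean-in-tree rule).  Part of the lit-balaban TYPED SKELETON (HOME `run/shared/lean/pub/lit-balaban/`), Phase 2, proof
seat **p40** generation 71 (unit `lit-balaban-p40`; the fold owner's offer (c) of 2026-08-23T01:57:43Z, TAKING line HOME/STATUS.md
2026-08-23T02:03Z).  Row **B3.Eq3.21-3.24** of `HOME/lit-balaban-r15/ROWS-B3.md` (fold owner r15), the owner's named residual (iii)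
after ROWS v1.207 (*"print's carrier for (3.4)–(3.38) is the zero-field infinite-lattice scalar propagator G_k(0) = G_k(ηℤ^d,0)"*):
*"(3.22)/(3.23) with bodies on the ηℤ³ carrier"*.  THIS FILE is the `ℤ^{d+1}` twin (FILE 1 of 2; every `d`) of the TORUS files of
record p18 g8 `B3Eq322OneLegDifferentiated` (p305718: `expr321a`, `ker321`, `expr321b`, `rem322`, `holder322`, `eq322`,
`sum_expr321b_eq`) and `B3Eq322PositiveDegree` (p305955: `abs_ker321_le`, `abs_rem322_le`, the weight lemma `exp_mul_rpow_le` — used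
BY NAME) and of r15's `B3Sect3ScalarSelfEnergy.bracket323`/`expr323`/`d1Kernel`/`bracket323_split` (p245397), written in the
vocabulary of p26 g34's lattice chain (`B3Taylor310Lattice`: `pd`, `dist₁`, `HolderDeriv`; `B3Ineq313Lattice`: `KernelZ`, `kernelOpOn`,
the finite localization sets `Λ`, `Λ′`; `B3Ineq314ZeroLattice`: the pieces `gpieceZ`, `etaZ`, `scaleZ`, the resummed `GresumZ`,
`abs_gpieceZ_le`; `B3Ineq211ZeroLattice.ineq210_zeroLatticeH` = (2.10) for the pieces of `G_k(0)`) — same architecture and names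
with the suffix `Z`; nothing of another seat is modified.  FILE 2 (`B3Eq323ZeroLattice`, `d = 3`) treats the p. 439 sentences after
(3.23) for the print's propagator `G^ξ_{j″}(0)` on `ξℤ³`.

THE PRINTED TEXT (verbatim, pp. 438–439).  *"We have to consider another class of graphs with two external scalar field legs, the
graphs with one leg differentiated. There are only two such graphs: [picture a] , [picture b] (3.21) The expression corresponding to
the first graph is in fact convergent, because ηG_k(x,x) is convergent to some finite constant as η → 0. The second expression is
transformed in a way similar to (3.17) and (3.20): [picture b] = [picture b with the vertex label +α and the leg label −(1+α)] +
[a local two-scalar-leg vertex with one leg differentiated] (3.22) The first graph on the right side has positive degree, the second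
is treated in the same way as the expression (3.15): we sum over proper orderings and j-indices and we get
Σ_{μ=1}^d Σ_x η^dφ(x)·[q²Σ_{x′}η^d(∂^η_μG^η_{j″}(0))(x,x′)g(x)G^η_{j″}(x,x′)g′(x′)](∂^η_μφ′)(x). (3.23) Further if we take
g′(x′) = g′(x) + ((g′(x′) − g′(x))/|x′ − x|)|x′ − x|, then the expression in the square bracket in (3.23) containing the second term
will be convergent and the expression with the first term is equal to q²g(x)g′(x)Σ_{x′}η^d(∂^η_μG^η_{j″}(0))(x,x′)G^η_{j″}(x,x′)."*

READING OF THE PICTURES (as in p18 g8's torus file, forced by (3.23)).  Graph (b): the vertex at `x` carries the undifferentiated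
external leg `φ(x)` and the derivative on the internal scalar line — kernel `(∂^η_μG_{(j)}(0))(x,x′)` (`d1KernelZ η⁻¹ μ G_{(j)}(0)`) —,
the vertex at `x′` carries the DIFFERENTIATED external leg `(∂^η_μφ′)(x′)`; the vector line `G_{(j′)}(x,x′)δ_{μν}` identifies the two
directions; localizations `g(x)`, `g′(x′)`; the charge matrices act as `φ(x)·q²(∂^η_μφ′)(x′)`.  (3.22) is the ZERO-ORDER Taylor formula
for the differentiated leg, `(∂^η_μφ′)(x′) = (∂^η_μφ′)(x) + [(∂^η_μφ′)(x′) − (∂^η_μφ′)(x)]`: the local term IS (3.23) on the same pair of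
kernels (before the summation over orderings and indices), the difference term is the generalized graph *"+α … −(1+α)"*.  Graph (a):
the (1.8)_{2,0} vertex with its two vector legs contracted into the loop `G(x,x)`: a LOCAL vertex with the function `ηG(x,x)g(x)`.

DISPLAY ↦ DECLARATION (the owner's audit table; everything on `ℤ^{d+1}`, sums over finite localization sets `Λ ∋ x`, `Λ′ ∋ x′`).
* (3.21) graph (a) ↦ `expr321aZ` (def), `abs_expr321aZ_le` (a local vertex with coefficient `sup|ηG(x,x)g(x)|`), `expr321aZ_finset_sum`.
* (3.21) graph (b) ↦ `ker321Z`, `expr321bZ` (defs).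
* (3.22) ↦ **`eq322Z`**: `expr321bZ = rem322Z + expr323Z` (PROVED, every `η`, all kernels/fields); `rem322Z` = the first graph of
  the right side, `holder322Z` = its printed inserted-and-divided form, `rem322Z_eq_holder322Z`.
* *"The first graph on the right side has positive degree"* ↦ **`abs_rem322Z_le`** (the (3.13)-type pointwise estimate with the gain
  `(min(L^jη, L^{j′}η))^α`, under (2.10)-type kernel hypotheses) and **`abs_rem322Z_le_zeroLattice`** (hypotheses DISCHARGED for the
  pieces `G^η_{(j)}(0)`, `G^η_{(j′)}(0)` of `G_k(0)` on `ηℤ^{d+1}`).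
* (3.23) ↦ **`bracket323Z`**, **`expr323Z`** (defs with bodies; `d1KernelZ` = the kernel of `∂^η_μ ∘ G`, `pd_kernelOpOn`), the chain
  *"we sum over proper orderings and j-indices and we get (3.23)"* ↦ **`sum_expr321bZ_eq`** (every kernel family) and
  **`sum_expr321bZ_eq_zeroLattice`** (the pieces of `G_k(0)` resum to `𝒢_n = Σ_{j<n}G^η_{(j)}(0)`, (2.6)).
* p. 439 *"if we take g′(x′) = g′(x) + …"* ↦ `bracket323Z_split` (the algebraic splitting; the two convergence sentences and the
  rescaling/(3.24) chain are FILE 2, on `ξℤ³`).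

HONEST SCOPE / DECLARED DIVERGENCES (F7).  (i) ZERO BACKGROUND (`∂^η`, no parallel transport — the §3 setting p. 433), scalar fields
with values in a real inner-product space `W` (print: `ℝ^N`), charge matrix `q : W →ₗ W` with `‖qw‖ ≤ Q‖w‖`; internal-index structure
of the propagators = identity, and in the hypothesis-free corollaries BOTH lines of graph (b) are instantiated with the zero-field
scalar pieces `G^η_{(j)}(0)` (the vector-field piece at `A = 0` has the same kernel — the convention of the torus files of record
p305955/p266291 and of p39's `B3Bound316ZeroLattice`).  (ii) `|x − x′|` = the `ℓ¹` lattice distance `η·dist₁` (p26's divergence (ii));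
in `holder322Z` the inserted weight is `(η|x − x′|₁)^α`.  (iii) The sums of (3.21)–(3.23) run over explicit finite localization sets
`Λ, Λ′` (the supports of `g, g′`; `|g|,|g′| ≤ 1` are hypotheses).  (iv) The summation *"over proper orderings and j-indices"* is
taken literally over `[0,n)²` with `𝒢_n = Σ_{j<n}G^η_{(j)}(0)` ((2.6); the admissibility bookkeeping of orderings, row B3.Eq2.7, is
not re-derived — as in p20's `B3Resummation315`, p18's `sum_expr321b_eq`, p26's `eq315Z_zeroLattice`).  (v) Constants explicit in §3 and
existential in §4; every `d`; the cube-localized display form of (3.13) is not re-derived for `rem322Z` (p26's `sum_sum_le_cubesZ`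
applies verbatim to the pointwise bound).  (vi) NOT claimed here: the LIMIT `ηG_k(x,x) → const` (p39 g17 `B3GkTadpoleLimitZeroLattice`,
on `ξℤ³`), the p. 439 convergence/rescaling/(3.24) sentences (FILE 2), the pictures (3.21)/(3.22) as graph objects (p18's
`B3Sect3LowestOrderGraphs.g321a/g321b`; residual (iv) of the row), `d = 2`-specific statements (residual (v)).  Theorems and
definitions with bodies only; no Literature fact minted, no `sorry`; standard axioms.  Value = (3.21)–(3.23) on the printed carrier,
NOT summit progress.  Unit `lit-balaban-p40` (Phase-2 proof seat p40, gen 71); HOME `run/shared/lean/pub/lit-balaban/` (row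
B3.Eq3.21-3.24, FILED.md, STATUS.md), 2026-08-23.
-/

open scoped BigOperators RealInnerProductSpace

namespace Literature.MathematicalPhysics.QuantumFieldTheory.Balaban1983to89.B3Eq322ZeroLattice

open B3Taylor310Lattice B3Ineq313Lattice B3Ineq314ZeroLattice
open B3Ineq210ZeroLattice (pieceLat)
open B3Ineq211ZeroLattice (zeroLatticeKernelsH ineq210_zeroLatticeH)
open B3Eq322PositiveDegree (exp_mul_rpow_le)
open Literature.MathematicalPhysics.QuantumFieldTheory.Balaban1983to89.B4ContourShift (supNorm abs_le_supNorm)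

noncomputable section

variable {d : ℕ}

/-! ## §1 The kernel `(∂^η_μ G)(x,x′)` and the expressions of (3.21), (3.22), (3.23) on `ηℤ^{d+1}` -/

section Expressions

variable {W : Type*} [NormedAddCommGroup W] [InnerProductSpace ℝ W]

/-- **The kernel `(∂^η_μ G)(x, x′)`** of (3.23) on `ηℤ^{d+1}`: the forward difference quotient of `G(·, x′)` at `x` in the direction
`μ`, `c(G(x + e_μ, x′) − G(x, x′))`, `c = η⁻¹` (the `ℤ^{d+1}` twin of `B3Sect3ScalarSelfEnergy.d1Kernel`; that it is the kernel of
`∂^η_μ ∘ G` is `pd_kernelOpOn`). [cite: Balaban1983Higgs3, (3.23) p.439] -/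
def d1KernelZ (c : ℝ) (μ : Fin (d + 1)) (G : KernelZ d) : KernelZ d :=
  fun x x' => c * (G (x + Pi.single μ 1) x' - G x x')

/-- **`d1KernelZ` is the kernel of `∂^η_μ ∘ G`**: `∂^η_μ(y ↦ Σ_{x′∈T} wG(y,x′)f(x′)) = Σ_{x′∈T} w(∂^η_μG)(y,x′)f(x′)` for every finite
summation set `T` and volume element `w`. [cite: Balaban1983Higgs3, (3.23) p.439] -/
theorem pd_kernelOpOn (T : Finset (Fin (d + 1) → ℤ)) (w c : ℝ) (μ : Fin (d + 1)) (G : KernelZ d)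
    (f : (Fin (d + 1) → ℤ) → ℝ) (y : Fin (d + 1) → ℤ) :
    pd c μ (kernelOpOn T w G f) y = kernelOpOn T w (d1KernelZ c μ G) f y := by
  simp only [pd, kernelOpOn, d1KernelZ, smul_eq_mul, Finset.mul_sum, ← Finset.sum_sub_distrib]
  exact Finset.sum_congr rfl fun x' _ => by ring

/-- **(3.21) p. 438 [PDF 28], the FIRST graph** (one vertex, two external scalar legs one of which is differentiated, a vector-field
loop) on `ηℤ^{d+1}`: `Σ_μΣ_{x∈Λ}η^d·(ηG(x,x))·g(x)·φ(x)·q²(∂^η_μφ′)(x)` — a local vertex with the function `ηG(x,x)` (*"ηG_k(x,x) is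
convergent to some finite constant as η → 0"*), couplings and the factor `½` of the (1.8)_{2,0} vertex extracted, `Λ` the
localization set of `g`. [cite: Balaban1983Higgs3, (3.21) p.438] -/
def expr321aZ (η : ℝ) (q : W →ₗ[ℝ] W) (G : KernelZ d) (g : (Fin (d + 1) → ℤ) → ℝ) (φ φ' : (Fin (d + 1) → ℤ) → W)
    (Λ : Finset (Fin (d + 1) → ℤ)) : ℝ :=
  ∑ μ : Fin (d + 1), ∑ x ∈ Λ, η ^ (d + 1) * (η * G x x * g x * ⟪φ x, q (q (pd η⁻¹ μ φ' x))⟫)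

/-- **(3.21) p. 438, the SECOND graph, its two-point kernel** without the charge matrices on `ηℤ^{d+1}`:
`k_μ(x,x′) = (∂^η_μG_{(j)}(0))(x,x′)g(x)G_{(j′)}(x,x′)g′(x′)` — the integrand of the square bracket of (3.23).
[cite: Balaban1983Higgs3, (3.21) p.438, (3.23) p.439] -/
def ker321Z (η : ℝ) (μ : Fin (d + 1)) (G0 Gj : KernelZ d) (g g' : (Fin (d + 1) → ℤ) → ℝ) : KernelZ d :=
  fun x x' => d1KernelZ η⁻¹ μ G0 x x' * g x * Gj x x' * g' x'

/-- **The square bracket of (3.23)** p. 439 [PDF 29] without `q²`, on `ηℤ^{d+1}`: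
`[·](x) = Σ_{x′∈Λ′}η^d(∂^η_μG^η_{j″}(0))(x,x′)g(x)G^η_{j″}(x,x′)g′(x′)` (`G0` = `G^η_{j″}(0)`, `Gj` = `G^η_{j″}`; `Λ′` the localization set of
`g′`; the `ℤ^{d+1}` twin of `B3Sect3ScalarSelfEnergy.bracket323`). [cite: Balaban1983Higgs3, (3.23) p.439] -/
def bracket323Z (η : ℝ) (μ : Fin (d + 1)) (G0 Gj : KernelZ d) (g g' : (Fin (d + 1) → ℤ) → ℝ)
    (Λ' : Finset (Fin (d + 1) → ℤ)) (x : Fin (d + 1) → ℤ) : ℝ :=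
  ∑ x' ∈ Λ', η ^ (d + 1) * ker321Z η μ G0 Gj g g' x x'

/-- **(3.23)** p. 439 [PDF 29] on `ηℤ^{d+1}`, verbatim: *"we sum over proper orderings and j-indices and we get
Σ_{μ=1}^d Σ_x η^dφ(x)·[q²Σ_{x′}η^d(∂^η_μG^η_{j″}(0))(x,x′)g(x)G^η_{j″}(x,x′)g′(x′)](∂^η_μφ′)(x). (3.23)"* — the derivative of the leg is
the concrete forward difference `pd η⁻¹ μ φ′`, `q²` acts on it; `x ∈ Λ`, `x′ ∈ Λ′` (the `ℤ^{d+1}` twin of `B3Sect3ScalarSelfEnergy.expr323`).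
[cite: Balaban1983Higgs3, (3.23) p.439] -/
def expr323Z (η : ℝ) (q : W →ₗ[ℝ] W) (G0 Gj : KernelZ d) (g g' : (Fin (d + 1) → ℤ) → ℝ) (φ φ' : (Fin (d + 1) → ℤ) → W)
    (Λ Λ' : Finset (Fin (d + 1) → ℤ)) : ℝ :=
  ∑ μ : Fin (d + 1), ∑ x ∈ Λ, η ^ (d + 1) * (bracket323Z η μ G0 Gj g g' Λ' x * ⟪φ x, q (q (pd η⁻¹ μ φ' x))⟫)

/-- **(3.21) p. 438 [PDF 28], the SECOND graph** on `ηℤ^{d+1}` (vertices `x ∈ Λ`, `x′ ∈ Λ′` joined by the scalar line `G_{(j)}(0)` —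
differentiated at `x` — and the vector line `G_{(j′)}`; the external leg `φ` at `x`, the DIFFERENTIATED external leg `∂^η_μφ′` at `x′`):
`Σ_μΣ_{x,x′}η^{2d}(∂^η_μG_{(j)}(0))(x,x′)g(x)G_{(j′)}(x,x′)g′(x′)·φ(x)·q²(∂^η_μφ′)(x′)`. [cite: Balaban1983Higgs3, (3.21) p.438] -/
def expr321bZ (η : ℝ) (q : W →ₗ[ℝ] W) (G0 Gj : KernelZ d) (g g' : (Fin (d + 1) → ℤ) → ℝ) (φ φ' : (Fin (d + 1) → ℤ) → W)
    (Λ Λ' : Finset (Fin (d + 1) → ℤ)) : ℝ :=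
  ∑ μ : Fin (d + 1), ∑ x ∈ Λ, ∑ x' ∈ Λ',
    η ^ (2 * (d + 1)) * (ker321Z η μ G0 Gj g g' x x' * ⟪φ x, q (q (pd η⁻¹ μ φ' x'))⟫)

/-- **(3.22) p. 439 [PDF 29], the FIRST graph of the right side** (vertex label `+α`, leg label `−(1+α)`), in plain form on `ηℤ^{d+1}`:
the kernel of the second graph of (3.21) paired with the DIFFERENCE `(∂^η_μφ′)(x′) − (∂^η_μφ′)(x)` of the differentiated leg.
[cite: Balaban1983Higgs3, (3.22) p.439] -/
def rem322Z (η : ℝ) (q : W →ₗ[ℝ] W) (G0 Gj : KernelZ d) (g g' : (Fin (d + 1) → ℤ) → ℝ) (φ φ' : (Fin (d + 1) → ℤ) → W)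
    (Λ Λ' : Finset (Fin (d + 1) → ℤ)) : ℝ :=
  ∑ μ : Fin (d + 1), ∑ x ∈ Λ, ∑ x' ∈ Λ',
    η ^ (2 * (d + 1)) * (ker321Z η μ G0 Gj g g' x x' * ⟪φ x, q (q (pd η⁻¹ μ φ' x' - pd η⁻¹ μ φ' x))⟫)

/-- **(3.22) p. 439, the first graph of the right side in the printed form of (3.19)/(3.20)** on `ηℤ^{d+1}`: the kernel gains the weight
`|x − x′|^α` (*"+α"*), the leg becomes the Hölder quotient of its derivative `((∂^η_μφ′)(x′) − (∂^η_μφ′)(x))/|x − x′|^α` (*"−(1+α)"*),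
`|x − x′| = η|x − x′|₁`. [cite: Balaban1983Higgs3, (3.22) p.439] -/
def holder322Z (η α : ℝ) (q : W →ₗ[ℝ] W) (G0 Gj : KernelZ d) (g g' : (Fin (d + 1) → ℤ) → ℝ) (φ φ' : (Fin (d + 1) → ℤ) → W)
    (Λ Λ' : Finset (Fin (d + 1) → ℤ)) : ℝ :=
  ∑ μ : Fin (d + 1), ∑ x ∈ Λ, ∑ x' ∈ Λ',
    η ^ (2 * (d + 1)) * ((ker321Z η μ G0 Gj g g' x x' * (η * (dist₁ x x' : ℝ)) ^ α) *
      ⟪φ x, q (q (((η * (dist₁ x x' : ℝ)) ^ α)⁻¹ • (pd η⁻¹ μ φ' x' - pd η⁻¹ μ φ' x)))⟫)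

/-- kernel: the bracket of (3.23) is the `x′`-sum of the kernel of the second graph of (3.21). [cite: Balaban1983Higgs3, (3.23) p.439] -/
theorem bracket323Z_eq (η : ℝ) (μ : Fin (d + 1)) (G0 Gj : KernelZ d) (g g' : (Fin (d + 1) → ℤ) → ℝ)
    (Λ' : Finset (Fin (d + 1) → ℤ)) (x : Fin (d + 1) → ℤ) :
    bracket323Z η μ G0 Gj g g' Λ' x =
      ∑ x' ∈ Λ', η ^ (d + 1) * (d1KernelZ η⁻¹ μ G0 x x' * g x * Gj x x' * g' x') := rfl

/-- **(3.22)** p. 439 [PDF 29], verbatim: *"The second expression is transformed in a way similar to (3.17) and (3.20): [second graph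
of (3.21)] = [the same graph with labels +α, −(1+α)] + [local vertex] (3.22) … the second is treated in the same way as the expression
(3.15)"* — PROVED ON `ηℤ^{d+1}` as the identity it is (the zero-order Taylor formula for the differentiated leg, by bilinearity of the
pairing): for every `η`, all line kernels, localizations, fields and localization sets, `expr321bZ = rem322Z + expr323Z`, the local
term being the (3.23)-expression on the SAME kernels `G_{(j)}(0)`, `G_{(j′)}` (before the summation over orderings and indices).
[cite: Balaban1983Higgs3, (3.22) p.439] -/
theorem eq322Z (η : ℝ) (q : W →ₗ[ℝ] W) (G0 Gj : KernelZ d) (g g' : (Fin (d + 1) → ℤ) → ℝ) (φ φ' : (Fin (d + 1) → ℤ) → W)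
    (Λ Λ' : Finset (Fin (d + 1) → ℤ)) :
    expr321bZ η q G0 Gj g g' φ φ' Λ Λ' = rem322Z η q G0 Gj g g' φ φ' Λ Λ' + expr323Z η q G0 Gj g g' φ φ' Λ Λ' := by
  have h2d : η ^ (2 * (d + 1)) = η ^ (d + 1) * η ^ (d + 1) := by rw [two_mul, pow_add]
  unfold expr321bZ rem322Z expr323Z
  rw [← Finset.sum_add_distrib]
  refine Finset.sum_congr rfl fun μ _ => ?_
  rw [← Finset.sum_add_distrib]
  refine Finset.sum_congr rfl fun x _ => ?_
  rw [bracket323Z, Finset.sum_mul, Finset.mul_sum, ← Finset.sum_add_distrib]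
  refine Finset.sum_congr rfl fun x' _ => ?_
  rw [map_sub, map_sub, inner_sub_right, h2d]
  ring

/-- kernel: distinct lattice points are at `ℓ¹` distance at least one. [folklore] -/
private theorem one_le_dist₁_of_ne {x x' : Fin (d + 1) → ℤ} (hx : x ≠ x') : 1 ≤ dist₁ x x' := by
  by_contra h0
  push Not at h0
  have h00 : dist₁ x x' = 0 := by omega
  apply hx
  funext ν
  have hν := Finset.sum_eq_zero_iff.mp h00 ν (Finset.mem_univ ν)
  have : x ν - x' ν = 0 := Int.natAbs_eq_zero.mp hν
  linarith

/-- **(3.22), the first graph of the right side in the printed (3.19)-form**: for every exponent `α` and `η > 0`, `rem322Z = holder322Z`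
(the `x′ = x` terms vanish on both sides; off the diagonal `|x − x′|^α·|x − x′|^{−α} = 1`, `|x − x′| = η|x − x′|₁ > 0`).
[cite: Balaban1983Higgs3, (3.22) p.439] -/
theorem rem322Z_eq_holder322Z {η : ℝ} (hη : 0 < η) (α : ℝ) (q : W →ₗ[ℝ] W) (G0 Gj : KernelZ d) (g g' : (Fin (d + 1) → ℤ) → ℝ)
    (φ φ' : (Fin (d + 1) → ℤ) → W) (Λ Λ' : Finset (Fin (d + 1) → ℤ)) :
    rem322Z η q G0 Gj g g' φ φ' Λ Λ' = holder322Z η α q G0 Gj g g' φ φ' Λ Λ' := by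
  unfold rem322Z holder322Z
  refine Finset.sum_congr rfl fun μ _ => Finset.sum_congr rfl fun x _ => Finset.sum_congr rfl fun x' _ => ?_
  congr 1
  by_cases hx : x = x'
  · subst hx
    simp
  · have hd1 : 0 < (dist₁ x x' : ℝ) := by exact_mod_cast one_le_dist₁_of_ne hx
    have hd : (η * (dist₁ x x' : ℝ)) ^ α ≠ 0 := (Real.rpow_pos_of_pos (mul_pos hη hd1) α).ne'
    rw [map_smul, map_smul, real_inner_smul_right, mul_assoc (ker321Z η μ G0 Gj g g' x x'),
      ← mul_assoc ((η * (dist₁ x x' : ℝ)) ^ α), mul_inv_cancel₀ hd, one_mul]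

/-- **(3.21), the first graph is a LOCAL vertex with the function `ηG(x,x)g(x)`** on `ηℤ^{d+1}`: if `|ηG(x,x)g(x)| ≤ B` on `Λ`, then
`|expr321aZ| ≤ B·Σ_μΣ_{x∈Λ}η^d‖φ(x)‖‖q²(∂^η_μφ′)(x)‖` (`η ≥ 0`) — the shape of *"a vertex with some convergent function"*.
[cite: Balaban1983Higgs3, (3.21) p.438] -/
theorem abs_expr321aZ_le {η B : ℝ} (hη : 0 ≤ η) (q : W →ₗ[ℝ] W) (G : KernelZ d) (g : (Fin (d + 1) → ℤ) → ℝ)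
    {Λ : Finset (Fin (d + 1) → ℤ)} (hB : ∀ x ∈ Λ, |η * G x x * g x| ≤ B) (φ φ' : (Fin (d + 1) → ℤ) → W) :
    |expr321aZ η q G g φ φ' Λ| ≤
      B * ∑ μ : Fin (d + 1), ∑ x ∈ Λ, η ^ (d + 1) * (‖φ x‖ * ‖q (q (pd η⁻¹ μ φ' x))‖) := by
  unfold expr321aZ
  rw [Finset.mul_sum]
  refine (Finset.abs_sum_le_sum_abs _ _).trans (Finset.sum_le_sum fun μ _ => ?_)
  rw [Finset.mul_sum]
  refine (Finset.abs_sum_le_sum_abs _ _).trans (Finset.sum_le_sum fun x hx => ?_)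
  rw [abs_mul, abs_of_nonneg (by positivity : (0 : ℝ) ≤ η ^ (d + 1)), abs_mul]
  have hi : |⟪φ x, q (q (pd η⁻¹ μ φ' x))⟫| ≤ ‖φ x‖ * ‖q (q (pd η⁻¹ μ φ' x))‖ := abs_real_inner_le_norm _ _
  have hB0 : 0 ≤ B := (abs_nonneg _).trans (hB x hx)
  calc η ^ (d + 1) * (|η * G x x * g x| * |⟪φ x, q (q (pd η⁻¹ μ φ' x))⟫|)
      ≤ η ^ (d + 1) * (B * (‖φ x‖ * ‖q (q (pd η⁻¹ μ φ' x))‖)) :=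
        mul_le_mul_of_nonneg_left (mul_le_mul (hB x hx) hi (abs_nonneg _) hB0) (by positivity)
    _ = B * (η ^ (d + 1) * (‖φ x‖ * ‖q (q (pd η⁻¹ μ φ' x))‖)) := by ring

/-- p. 439, after (3.23), verbatim: *"Further if we take g′(x′) = g′(x) + ((g′(x′) − g′(x))/|x′ − x|)|x′ − x|, then the expression in
the square bracket in (3.23) containing the second term will be convergent and the expression with the first term is equal to
q²g(x)g′(x)Σ_{x′}η^d(∂^η_μG^η_{j″}(0))(x,x′)G^η_{j″}(x,x′)."* — PROVED ON `ηℤ^{d+1}` as the splitting of the bracket (the convergence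
sentences and the rescaling/(3.24) chain are FILE 2 `B3Eq323ZeroLattice`, on `ξℤ³`). [cite: Balaban1983Higgs3, (3.23) p.439] -/
theorem bracket323Z_split (η : ℝ) (μ : Fin (d + 1)) (G0 Gj : KernelZ d) (g g' : (Fin (d + 1) → ℤ) → ℝ)
    (Λ' : Finset (Fin (d + 1) → ℤ)) (x : Fin (d + 1) → ℤ) :
    bracket323Z η μ G0 Gj g g' Λ' x =
      g x * g' x * (∑ x' ∈ Λ', η ^ (d + 1) * (d1KernelZ η⁻¹ μ G0 x x' * Gj x x')) +
        ∑ x' ∈ Λ', η ^ (d + 1) * (d1KernelZ η⁻¹ μ G0 x x' * g x * Gj x x' * (g' x' - g' x)) := by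
  rw [bracket323Z, Finset.mul_sum, ← Finset.sum_add_distrib]
  exact Finset.sum_congr rfl fun x' _ => by rw [ker321Z]; ring

end Expressions

/-! ## §2 The chain (3.22) → (3.23): "we sum over proper orderings and j-indices" -/

section Resum

variable {W : Type*} [NormedAddCommGroup W] [InnerProductSpace ℝ W] {ι κ : Type*} (s : Finset ι) (t : Finset κ)

/-- kernel: a finite sum of two-point kernels evaluated at a pair of sites. [folklore] -/
private theorem sum_kernel_apply (G : ι → KernelZ d) (x x' : Fin (d + 1) → ℤ) :
    (∑ i ∈ s, G i) x x' = ∑ i ∈ s, (G i) x x' := by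
  rw [Finset.sum_apply, Finset.sum_apply]

/-- kernel: a family index pulled out of a double sum (finite type × finite set). [folklore] -/
private theorem sum_rot2 {α β : Type*} [Fintype α] (Λ : Finset β) (f : α → β → ι → ℝ) :
    ∑ a : α, ∑ b ∈ Λ, ∑ i ∈ s, f a b i = ∑ i ∈ s, ∑ a : α, ∑ b ∈ Λ, f a b i := by
  calc ∑ a : α, ∑ b ∈ Λ, ∑ i ∈ s, f a b i = ∑ a : α, ∑ i ∈ s, ∑ b ∈ Λ, f a b i :=
        Finset.sum_congr rfl fun a _ => Finset.sum_comm
    _ = ∑ i ∈ s, ∑ a : α, ∑ b ∈ Λ, f a b i := Finset.sum_comm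

/-- kernel: two family indices pulled out of a sum over a finite set. [folklore] -/
private theorem sum_rot2' {β : Type*} (Λ : Finset β) (f : β → ι → κ → ℝ) :
    ∑ b ∈ Λ, ∑ i ∈ s, ∑ i' ∈ t, f b i i' = ∑ i ∈ s, ∑ i' ∈ t, ∑ b ∈ Λ, f b i i' := by
  calc ∑ b ∈ Λ, ∑ i ∈ s, ∑ i' ∈ t, f b i i' = ∑ i ∈ s, ∑ b ∈ Λ, ∑ i' ∈ t, f b i i' := Finset.sum_comm
    _ = ∑ i ∈ s, ∑ i' ∈ t, ∑ b ∈ Λ, f b i i' := Finset.sum_congr rfl fun i _ => Finset.sum_comm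

/-- the kernel `(∂^η_μG)(x,x′)` commutes with finite sums of propagators (the summation over the index of the differentiated line).
[cite: Balaban1983Higgs3, (3.22)–(3.23) p.439] -/
theorem d1KernelZ_finset_sum (c : ℝ) (μ : Fin (d + 1)) (G : ι → KernelZ d) (x x' : Fin (d + 1) → ℤ) :
    d1KernelZ c μ (∑ i ∈ s, G i) x x' = ∑ i ∈ s, d1KernelZ c μ (G i) x x' := by
  simp only [d1KernelZ, sum_kernel_apply, ← Finset.sum_sub_distrib, Finset.mul_sum]

/-- The first graph of (3.21) is LINEAR in its loop propagator: on `G = Σ_iG_{(i)}` it is the sum of the expressions on the pieces.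
[cite: Balaban1983Higgs3, (3.21) p.438] -/
theorem expr321aZ_finset_sum (η : ℝ) (q : W →ₗ[ℝ] W) (G : ι → KernelZ d) (g : (Fin (d + 1) → ℤ) → ℝ)
    (φ φ' : (Fin (d + 1) → ℤ) → W) (Λ : Finset (Fin (d + 1) → ℤ)) :
    expr321aZ η q (∑ i ∈ s, G i) g φ φ' Λ = ∑ i ∈ s, expr321aZ η q (G i) g φ φ' Λ := by
  unfold expr321aZ
  simp only [sum_kernel_apply, Finset.mul_sum, Finset.sum_mul]
  exact sum_rot2 s Λ _

/-- The kernel of the second graph of (3.21) is BILINEAR in its two line propagators: for `G₀ = Σ_iG₀ᵢ`, `G = Σ_{i′}G_{i′}`,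
`k[G₀,G](x,x′) = Σ_iΣ_{i′}k[G₀ᵢ,G_{i′}](x,x′)`. [cite: Balaban1983Higgs3, (3.22)–(3.23) p.439] -/
theorem ker321Z_sum_sum (η : ℝ) (μ : Fin (d + 1)) (G0 : ι → KernelZ d) (G : κ → KernelZ d) (g g' : (Fin (d + 1) → ℤ) → ℝ)
    (x x' : Fin (d + 1) → ℤ) :
    ker321Z η μ (∑ i ∈ s, G0 i) (∑ i' ∈ t, G i') g g' x x' = ∑ i ∈ s, ∑ i' ∈ t, ker321Z η μ (G0 i) (G i') g g' x x' := by
  simp only [ker321Z, d1KernelZ_finset_sum, sum_kernel_apply]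
  rw [Finset.sum_mul, Finset.sum_mul, Finset.sum_mul]
  refine Finset.sum_congr rfl fun i _ => ?_
  rw [Finset.mul_sum, Finset.sum_mul]

/-- The bracket of (3.23) is BILINEAR in its two propagators. [cite: Balaban1983Higgs3, (3.23) p.439] -/
theorem bracket323Z_sum_sum (η : ℝ) (μ : Fin (d + 1)) (G0 : ι → KernelZ d) (G : κ → KernelZ d) (g g' : (Fin (d + 1) → ℤ) → ℝ)
    (Λ' : Finset (Fin (d + 1) → ℤ)) (x : Fin (d + 1) → ℤ) :
    bracket323Z η μ (∑ i ∈ s, G0 i) (∑ i' ∈ t, G i') g g' Λ' x = ∑ i ∈ s, ∑ i' ∈ t, bracket323Z η μ (G0 i) (G i') g g' Λ' x := by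
  unfold bracket323Z
  simp only [ker321Z_sum_sum, Finset.mul_sum]
  exact sum_rot2' s t Λ' _

/-- **(3.23) is BILINEAR in its two propagators** (*"we sum over proper orderings and j-indices"*: the double sum over the indices of the
two internal lines of the expressions on the pieces is the expression on the summed propagators; the `ℤ^{d+1}` twin of p20's
`B3Resummation315.expr323_sum_sum`). [cite: Balaban1983Higgs3, (3.23) p.439] -/
theorem expr323Z_sum_sum (η : ℝ) (q : W →ₗ[ℝ] W) (G0 : ι → KernelZ d) (G : κ → KernelZ d) (g g' : (Fin (d + 1) → ℤ) → ℝ)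
    (φ φ' : (Fin (d + 1) → ℤ) → W) (Λ Λ' : Finset (Fin (d + 1) → ℤ)) :
    expr323Z η q (∑ i ∈ s, G0 i) (∑ i' ∈ t, G i') g g' φ φ' Λ Λ' =
      ∑ i ∈ s, ∑ i' ∈ t, expr323Z η q (G0 i) (G i') g g' φ φ' Λ Λ' := by
  unfold expr323Z
  simp only [bracket323Z_sum_sum, Finset.sum_mul, Finset.mul_sum]
  -- Σ_μ Σ_x Σ_i Σ_i' → Σ_i Σ_i' Σ_μ Σ_x
  calc ∑ μ : Fin (d + 1), ∑ x ∈ Λ, ∑ i ∈ s, ∑ i' ∈ t,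
          η ^ (d + 1) * (bracket323Z η μ (G0 i) (G i') g g' Λ' x * ⟪φ x, q (q (pd η⁻¹ μ φ' x))⟫)
      = ∑ μ : Fin (d + 1), ∑ i ∈ s, ∑ i' ∈ t, ∑ x ∈ Λ,
          η ^ (d + 1) * (bracket323Z η μ (G0 i) (G i') g g' Λ' x * ⟪φ x, q (q (pd η⁻¹ μ φ' x))⟫) := by
        refine Finset.sum_congr rfl fun μ _ => ?_
        rw [Finset.sum_comm]
        exact Finset.sum_congr rfl fun i _ => Finset.sum_comm
    _ = ∑ i ∈ s, ∑ μ : Fin (d + 1), ∑ i' ∈ t, ∑ x ∈ Λ,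
          η ^ (d + 1) * (bracket323Z η μ (G0 i) (G i') g g' Λ' x * ⟪φ x, q (q (pd η⁻¹ μ φ' x))⟫) := Finset.sum_comm
    _ = ∑ i ∈ s, ∑ i' ∈ t, ∑ μ : Fin (d + 1), ∑ x ∈ Λ,
          η ^ (d + 1) * (bracket323Z η μ (G0 i) (G i') g g' Λ' x * ⟪φ x, q (q (pd η⁻¹ μ φ' x))⟫) :=
        Finset.sum_congr rfl fun i _ => Finset.sum_comm

/-- The second graph of (3.21) is BILINEAR in its two line propagators. [cite: Balaban1983Higgs3, (3.22)–(3.23) p.439] -/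
theorem expr321bZ_sum_sum (η : ℝ) (q : W →ₗ[ℝ] W) (G0 : ι → KernelZ d) (G : κ → KernelZ d) (g g' : (Fin (d + 1) → ℤ) → ℝ)
    (φ φ' : (Fin (d + 1) → ℤ) → W) (Λ Λ' : Finset (Fin (d + 1) → ℤ)) :
    expr321bZ η q (∑ i ∈ s, G0 i) (∑ i' ∈ t, G i') g g' φ φ' Λ Λ' =
      ∑ i ∈ s, ∑ i' ∈ t, expr321bZ η q (G0 i) (G i') g g' φ φ' Λ Λ' := by
  unfold expr321bZ
  simp only [ker321Z_sum_sum, Finset.sum_mul, Finset.mul_sum]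
  -- Σ_μ Σ_x Σ_x' Σ_i Σ_i' → Σ_i Σ_i' Σ_μ Σ_x Σ_x'
  calc ∑ μ : Fin (d + 1), ∑ x ∈ Λ, ∑ x' ∈ Λ', ∑ i ∈ s, ∑ i' ∈ t,
          η ^ (2 * (d + 1)) * (ker321Z η μ (G0 i) (G i') g g' x x' * ⟪φ x, q (q (pd η⁻¹ μ φ' x'))⟫)
      = ∑ μ : Fin (d + 1), ∑ x ∈ Λ, ∑ i ∈ s, ∑ i' ∈ t, ∑ x' ∈ Λ',
          η ^ (2 * (d + 1)) * (ker321Z η μ (G0 i) (G i') g g' x x' * ⟪φ x, q (q (pd η⁻¹ μ φ' x'))⟫) := by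
        refine Finset.sum_congr rfl fun μ _ => Finset.sum_congr rfl fun x _ => ?_
        rw [Finset.sum_comm]
        exact Finset.sum_congr rfl fun i _ => Finset.sum_comm
    _ = ∑ μ : Fin (d + 1), ∑ i ∈ s, ∑ i' ∈ t, ∑ x ∈ Λ, ∑ x' ∈ Λ',
          η ^ (2 * (d + 1)) * (ker321Z η μ (G0 i) (G i') g g' x x' * ⟪φ x, q (q (pd η⁻¹ μ φ' x'))⟫) := by
        refine Finset.sum_congr rfl fun μ _ => ?_
        rw [Finset.sum_comm]
        exact Finset.sum_congr rfl fun i _ => Finset.sum_comm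
    _ = ∑ i ∈ s, ∑ μ : Fin (d + 1), ∑ i' ∈ t, ∑ x ∈ Λ, ∑ x' ∈ Λ',
          η ^ (2 * (d + 1)) * (ker321Z η μ (G0 i) (G i') g g' x x' * ⟪φ x, q (q (pd η⁻¹ μ φ' x'))⟫) := Finset.sum_comm
    _ = ∑ i ∈ s, ∑ i' ∈ t, ∑ μ : Fin (d + 1), ∑ x ∈ Λ, ∑ x' ∈ Λ',
          η ^ (2 * (d + 1)) * (ker321Z η μ (G0 i) (G i') g g' x x' * ⟪φ x, q (q (pd η⁻¹ μ φ' x'))⟫) :=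
        Finset.sum_congr rfl fun i _ => Finset.sum_comm

/-- The first graph of the right side of (3.22) is BILINEAR in its two line propagators (from `eq322Z` and the bilinearity of the two
other members). [cite: Balaban1983Higgs3, (3.22)–(3.23) p.439] -/
theorem rem322Z_sum_sum (η : ℝ) (q : W →ₗ[ℝ] W) (G0 : ι → KernelZ d) (G : κ → KernelZ d) (g g' : (Fin (d + 1) → ℤ) → ℝ)
    (φ φ' : (Fin (d + 1) → ℤ) → W) (Λ Λ' : Finset (Fin (d + 1) → ℤ)) :
    rem322Z η q (∑ i ∈ s, G0 i) (∑ i' ∈ t, G i') g g' φ φ' Λ Λ' =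
      ∑ i ∈ s, ∑ i' ∈ t, rem322Z η q (G0 i) (G i') g g' φ φ' Λ Λ' := by
  have h := eq322Z η q (∑ i ∈ s, G0 i) (∑ i' ∈ t, G i') g g' φ φ' Λ Λ'
  rw [expr321bZ_sum_sum, expr323Z_sum_sum] at h
  have h' : ∑ i ∈ s, ∑ i' ∈ t, expr321bZ η q (G0 i) (G i') g g' φ φ' Λ Λ' =
      (∑ i ∈ s, ∑ i' ∈ t, rem322Z η q (G0 i) (G i') g g' φ φ' Λ Λ') +
        ∑ i ∈ s, ∑ i' ∈ t, expr323Z η q (G0 i) (G i') g g' φ φ' Λ Λ' := by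
    rw [← Finset.sum_add_distrib]
    refine Finset.sum_congr rfl fun i _ => ?_
    rw [← Finset.sum_add_distrib]
    exact Finset.sum_congr rfl fun i' _ => eq322Z η q (G0 i) (G i') g g' φ φ' Λ Λ'
  linarith

/-- **(3.22) then (3.23), p. 439, ON `ηℤ^{d+1}`** — *"the second is treated in the same way as the expression (3.15): we sum over proper
orderings and j-indices and we get (3.23)"*: for every `η`, every `n` and all kernel families, the expressions of the second graph of
(3.21) with lines `G_{(i)}(0)`, `G_{(i′)}` summed over `i, i′ < n` EQUAL the sum of the generalized graphs `rem322Z[i,i′]` plus the local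
vertex (3.23) built on the resummed propagators `Σ_{i<n}G_{(i)}(0)`, `Σ_{i′<n}G_{(i′)}`. [cite: Balaban1983Higgs3, (3.22)–(3.23) p.439] -/
theorem sum_expr321bZ_eq (η : ℝ) (q : W →ₗ[ℝ] W) (n : ℕ) (G0fam Gfam : ℕ → KernelZ d) (g g' : (Fin (d + 1) → ℤ) → ℝ)
    (φ φ' : (Fin (d + 1) → ℤ) → W) (Λ Λ' : Finset (Fin (d + 1) → ℤ)) :
    ∑ i ∈ Finset.range n, ∑ i' ∈ Finset.range n, expr321bZ η q (G0fam i) (Gfam i') g g' φ φ' Λ Λ' =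
      (∑ i ∈ Finset.range n, ∑ i' ∈ Finset.range n, rem322Z η q (G0fam i) (Gfam i') g g' φ φ' Λ Λ') +
        expr323Z η q (∑ i ∈ Finset.range n, G0fam i) (∑ i' ∈ Finset.range n, Gfam i') g g' φ φ' Λ Λ' := by
  rw [expr323Z_sum_sum, ← Finset.sum_add_distrib]
  refine Finset.sum_congr rfl fun i _ => ?_
  rw [← Finset.sum_add_distrib]
  exact Finset.sum_congr rfl fun i' _ => eq322Z η q (G0fam i) (Gfam i') g g' φ φ' Λ Λ'

end Resum

/-! ## §3 "The first graph on the right side has positive degree": the (3.13)-type pointwise estimate of `rem322Z` -/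

section Bound

variable {W : Type*} [NormedAddCommGroup W] [InnerProductSpace ℝ W]

/-- kernel: `|φ(x)·q(qv)| ≤ ‖φ(x)‖·Q²·‖v‖` when `‖qw‖ ≤ Q‖w‖`. [folklore] -/
private theorem abs_inner_qq_le {Q : ℝ} (hQ : 0 ≤ Q) (q : W →ₗ[ℝ] W) (hq : ∀ w : W, ‖q w‖ ≤ Q * ‖w‖) (a v : W) :
    |⟪a, q (q v)⟫| ≤ ‖a‖ * (Q ^ 2 * ‖v‖) := by
  calc |⟪a, q (q v)⟫| ≤ ‖a‖ * ‖q (q v)‖ := abs_real_inner_le_norm _ _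
    _ ≤ ‖a‖ * (Q ^ 2 * ‖v‖) := by
        refine mul_le_mul_of_nonneg_left ?_ (norm_nonneg _)
        calc ‖q (q v)‖ ≤ Q * ‖q v‖ := hq _
          _ ≤ Q * (Q * ‖v‖) := mul_le_mul_of_nonneg_left (hq v) hQ
          _ = Q ^ 2 * ‖v‖ := by ring

/-- kernel: a constant dominating an absolute value through two positive factors is nonnegative. [folklore] -/
private theorem nonneg_of_abs_le_mul_mul {v C p e : ℝ} (h : |v| ≤ C * p * e) (hp : 0 < p) (he : 0 < e) : 0 ≤ C :=
  nonneg_of_mul_nonneg_left (nonneg_of_mul_nonneg_left ((abs_nonneg v).trans h) he) hp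

/-- kernel: the kernel of the second graph of (3.21) under the (2.10)-type bounds on `ηℤ^{d+1}` — `|k_μ(x,x′)| ≤ C₁s^{1−d}e^{−δu/s}·
C₂s′^{2−d}e^{−δu/s′}`, `u = η|x − x′|₁`, `|g|,|g′| ≤ 1`, dimension `d + 1` (one differentiation on the scalar line: the factor
`(L^jη)^{−1}` of (2.10); twin of `B3Eq322PositiveDegree.abs_ker321_le`). [cite: Balaban1983Higgs3, (2.10) p.426, (3.22) p.439] -/
theorem abs_ker321Z_le {η C₁ C₂ δ s s' : ℝ} {G0 Gj : KernelZ d} {g g' : (Fin (d + 1) → ℤ) → ℝ} {μ : Fin (d + 1)}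
    (hg : ∀ x, |g x| ≤ 1) (hg' : ∀ x, |g' x| ≤ 1)
    (hG0 : ∀ x x' : Fin (d + 1) → ℤ,
      |d1KernelZ η⁻¹ μ G0 x x'| ≤ C₁ * s ^ (1 - ((d + 1 : ℕ) : ℝ)) * Real.exp (-(δ * s⁻¹ * (η * dist₁ x x'))))
    (hGj : ∀ x x' : Fin (d + 1) → ℤ,
      |Gj x x'| ≤ C₂ * s' ^ (2 - ((d + 1 : ℕ) : ℝ)) * Real.exp (-(δ * s'⁻¹ * (η * dist₁ x x'))))
    (x x' : Fin (d + 1) → ℤ) :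
    |ker321Z η μ G0 Gj g g' x x'| ≤
      (C₁ * s ^ (1 - ((d + 1 : ℕ) : ℝ)) * Real.exp (-(δ * s⁻¹ * (η * dist₁ x x')))) *
        (C₂ * s' ^ (2 - ((d + 1 : ℕ) : ℝ)) * Real.exp (-(δ * s'⁻¹ * (η * dist₁ x x')))) := by
  have hA : 0 ≤ C₁ * s ^ (1 - ((d + 1 : ℕ) : ℝ)) * Real.exp (-(δ * s⁻¹ * (η * dist₁ x x'))) :=
    (abs_nonneg _).trans (hG0 x x')
  have hB : 0 ≤ C₂ * s' ^ (2 - ((d + 1 : ℕ) : ℝ)) * Real.exp (-(δ * s'⁻¹ * (η * dist₁ x x'))) :=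
    (abs_nonneg _).trans (hGj x x')
  have h1 := hg x
  have h2 := hGj x x'
  have h3 := hg' x'
  have h4 := hG0 x x'
  unfold ker321Z
  rw [abs_mul, abs_mul, abs_mul]
  calc |d1KernelZ η⁻¹ μ G0 x x'| * |g x| * |Gj x x'| * |g' x'|
      ≤ (C₁ * s ^ (1 - ((d + 1 : ℕ) : ℝ)) * Real.exp (-(δ * s⁻¹ * (η * dist₁ x x')))) * 1
          * (C₂ * s' ^ (2 - ((d + 1 : ℕ) : ℝ)) * Real.exp (-(δ * s'⁻¹ * (η * dist₁ x x')))) * 1 := by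
        gcongr
    _ = _ := by ring

/-- **p. 439 [PDF 29], "The first graph on the right side has positive degree" — PROVED quantitatively ON `ηℤ^{d+1}`, in the POINTWISE
form of (3.13)/(3.14)** (before the localization of the vertices into cubes): under the (2.10)-type bounds on the two lines at the scales
`s = L^jη` (the differentiated scalar line `G_{(j)}(0)`: `C₁s^{1−(d+1)}e^{−δ|x−x′|/s}`), `s′ = L^{j′}η` (the vector line:
`C₂s′^{2−(d+1)}e^{−δ|x−x′|/s′}`), localizations `|g|,|g′| ≤ 1`, charge matrix `‖qw‖ ≤ Q‖w‖` and the Hölder hypothesis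
`‖(∂^η_μφ′)(z) − (∂^η_μφ′)(z′)‖ ≤ H|z − z′|^α` (`HolderDeriv η⁻¹ α H φ′`, `0 ≤ α ≤ 1`) on the differentiated leg, for all finite
localization sets: `|rem322Z| ≤ (d+1)·C₁C₂Q²H(1 + 2/δ)·(min(s,s′))^α·Σ_{x∈Λ,x′∈Λ′}η^{2(d+1)}‖φ(x)‖·s^{1−(d+1)}e^{−½δ|x−x′|/s}·
s′^{2−(d+1)}e^{−½δ|x−x′|/s′}` — the factors of a generalized graph of degree `3 − (d+1) + α` (`= α > 0` for `d + 1 = 3`), the gain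
`(L^{j₁}η)^α`, `j₁ = min(j,j′)`, paid by half of the decay (p18's weight lemma `exp_mul_rpow_le`, p. 436 *"using half of the exponential
factor with index j₁"*; twin of `B3Eq322PositiveDegree.abs_rem322_le`). [cite: Balaban1983Higgs3, (3.22) p.439, (3.13) p.436] -/
theorem abs_rem322Z_le (η : ℝ) (hη : 0 < η) {α H Q C₁ C₂ δ s s' : ℝ} (hα0 : 0 ≤ α) (hα1 : α ≤ 1) (hH : 0 ≤ H) (hQ : 0 ≤ Q)
    (hδ : 0 < δ) (hs : 0 < s) (hs' : 0 < s') (q : W →ₗ[ℝ] W) (hq : ∀ w : W, ‖q w‖ ≤ Q * ‖w‖)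
    (G0 Gj : KernelZ d) (g g' : (Fin (d + 1) → ℤ) → ℝ) (hg : ∀ x, |g x| ≤ 1) (hg' : ∀ x, |g' x| ≤ 1)
    (hG0 : ∀ (μ : Fin (d + 1)) (x x' : Fin (d + 1) → ℤ),
      |d1KernelZ η⁻¹ μ G0 x x'| ≤ C₁ * s ^ (1 - ((d + 1 : ℕ) : ℝ)) * Real.exp (-(δ * s⁻¹ * (η * dist₁ x x'))))
    (hGj : ∀ x x' : Fin (d + 1) → ℤ,
      |Gj x x'| ≤ C₂ * s' ^ (2 - ((d + 1 : ℕ) : ℝ)) * Real.exp (-(δ * s'⁻¹ * (η * dist₁ x x'))))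
    (φ φ' : (Fin (d + 1) → ℤ) → W) (hφ' : HolderDeriv η⁻¹ α H φ') (Λ Λ' : Finset (Fin (d + 1) → ℤ)) :
    |rem322Z η q G0 Gj g g' φ φ' Λ Λ'| ≤
      (d + 1 : ℕ) * C₁ * C₂ * Q ^ 2 * H * (1 + 2 / δ) * (min s s') ^ α *
        ∑ x ∈ Λ, ∑ x' ∈ Λ', η ^ (2 * (d + 1)) *
          (‖φ x‖ * (s ^ (1 - ((d + 1 : ℕ) : ℝ)) * Real.exp (-(δ / 2 * s⁻¹ * (η * dist₁ x x'))))
            * (s' ^ (2 - ((d + 1 : ℕ) : ℝ)) * Real.exp (-(δ / 2 * s'⁻¹ * (η * dist₁ x x'))))) := by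
  have hC₁ : 0 ≤ C₁ := nonneg_of_abs_le_mul_mul (hG0 0 0 0) (Real.rpow_pos_of_pos hs _) (Real.exp_pos _)
  have hC₂ : 0 ≤ C₂ := nonneg_of_abs_le_mul_mul (hGj 0 0) (Real.rpow_pos_of_pos hs' _) (Real.exp_pos _)
  -- the constant without the factor `d + 1` (which comes from the sum over `μ`) and the per-term bound
  set K : ℝ := C₁ * C₂ * Q ^ 2 * H * (1 + 2 / δ) * (min s s') ^ α with hK
  have hK0 : 0 ≤ K := by
    rw [hK]
    have : 0 ≤ (min s s') ^ α := Real.rpow_nonneg (lt_min hs hs').le _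
    positivity
  set S : ℝ := ∑ x ∈ Λ, ∑ x' ∈ Λ', η ^ (2 * (d + 1)) *
      (‖φ x‖ * (s ^ (1 - ((d + 1 : ℕ) : ℝ)) * Real.exp (-(δ / 2 * s⁻¹ * (η * dist₁ x x'))))
        * (s' ^ (2 - ((d + 1 : ℕ) : ℝ)) * Real.exp (-(δ / 2 * s'⁻¹ * (η * dist₁ x x'))))) with hS
  have hterm : ∀ (μ : Fin (d + 1)) (x x' : Fin (d + 1) → ℤ),
      |η ^ (2 * (d + 1)) * (ker321Z η μ G0 Gj g g' x x' * ⟪φ x, q (q (pd η⁻¹ μ φ' x' - pd η⁻¹ μ φ' x))⟫)| ≤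
        K * (η ^ (2 * (d + 1)) * (‖φ x‖ * (s ^ (1 - ((d + 1 : ℕ) : ℝ)) * Real.exp (-(δ / 2 * s⁻¹ * (η * dist₁ x x'))))
          * (s' ^ (2 - ((d + 1 : ℕ) : ℝ)) * Real.exp (-(δ / 2 * s'⁻¹ * (η * dist₁ x x')))))) := by
    intro μ x x'
    set u : ℝ := η * dist₁ x x' with hu
    have hu0 : 0 ≤ u := mul_nonneg hη.le (Nat.cast_nonneg _)
    -- the leg: a differentiation of the order 1 + α
    have hleg : ‖pd η⁻¹ μ φ' x' - pd η⁻¹ μ φ' x‖ ≤ H * u ^ α := by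
      have h := hφ' μ x' x
      rw [inv_inv, dist₁_comm] at h
      exact h
    have hinner : |⟪φ x, q (q (pd η⁻¹ μ φ' x' - pd η⁻¹ μ φ' x))⟫| ≤ ‖φ x‖ * (Q ^ 2 * (H * u ^ α)) :=
      (abs_inner_qq_le hQ q hq _ _).trans
        (mul_le_mul_of_nonneg_left (mul_le_mul_of_nonneg_left hleg (sq_nonneg _)) (norm_nonneg _))
    have hker := abs_ker321Z_le (μ := μ) hg hg' (hG0 μ) hGj x x'
    have hA : 0 ≤ C₁ * s ^ (1 - ((d + 1 : ℕ) : ℝ)) * Real.exp (-(δ * s⁻¹ * u)) := by positivity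
    have hB : 0 ≤ C₂ * s' ^ (2 - ((d + 1 : ℕ) : ℝ)) * Real.exp (-(δ * s'⁻¹ * u)) := by positivity
    have hweight := exp_mul_rpow_le hδ hs hs' hu0 hα0 hα1
    have hX : 0 ≤ η ^ (2 * (d + 1)) * (C₁ * s ^ (1 - ((d + 1 : ℕ) : ℝ)) * (C₂ * s' ^ (2 - ((d + 1 : ℕ) : ℝ))) *
        (‖φ x‖ * Q ^ 2 * H)) := by positivity
    calc |η ^ (2 * (d + 1)) * (ker321Z η μ G0 Gj g g' x x' * ⟪φ x, q (q (pd η⁻¹ μ φ' x' - pd η⁻¹ μ φ' x))⟫)|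
        = η ^ (2 * (d + 1)) * (|ker321Z η μ G0 Gj g g' x x'| *
            |⟪φ x, q (q (pd η⁻¹ μ φ' x' - pd η⁻¹ μ φ' x))⟫|) := by
          rw [abs_mul, abs_mul, abs_of_nonneg (by positivity : (0:ℝ) ≤ η ^ (2 * (d + 1)))]
      _ ≤ η ^ (2 * (d + 1)) * (((C₁ * s ^ (1 - ((d + 1 : ℕ) : ℝ)) * Real.exp (-(δ * s⁻¹ * u))) *
            (C₂ * s' ^ (2 - ((d + 1 : ℕ) : ℝ)) * Real.exp (-(δ * s'⁻¹ * u)))) * (‖φ x‖ * (Q ^ 2 * (H * u ^ α)))) := by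
          refine mul_le_mul_of_nonneg_left ?_ (by positivity)
          exact mul_le_mul hker hinner (abs_nonneg _) (mul_nonneg hA hB)
      _ = η ^ (2 * (d + 1)) * (C₁ * s ^ (1 - ((d + 1 : ℕ) : ℝ)) * (C₂ * s' ^ (2 - ((d + 1 : ℕ) : ℝ))) *
            (‖φ x‖ * Q ^ 2 * H)) * (Real.exp (-(δ * s⁻¹ * u)) * Real.exp (-(δ * s'⁻¹ * u)) * u ^ α) := by ring
      _ ≤ η ^ (2 * (d + 1)) * (C₁ * s ^ (1 - ((d + 1 : ℕ) : ℝ)) * (C₂ * s' ^ (2 - ((d + 1 : ℕ) : ℝ))) *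
            (‖φ x‖ * Q ^ 2 * H)) * ((1 + 2 / δ) * (min s s') ^ α *
              (Real.exp (-(δ / 2 * s⁻¹ * u)) * Real.exp (-(δ / 2 * s'⁻¹ * u)))) :=
          mul_le_mul_of_nonneg_left hweight hX
      _ = K * (η ^ (2 * (d + 1)) * (‖φ x‖ * (s ^ (1 - ((d + 1 : ℕ) : ℝ)) * Real.exp (-(δ / 2 * s⁻¹ * u)))
          * (s' ^ (2 - ((d + 1 : ℕ) : ℝ)) * Real.exp (-(δ / 2 * s'⁻¹ * u))))) := by rw [hK]; ring
  -- summation: each `μ`-slice is bounded by `K·S`, and there are `d + 1` directions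
  have hslice : ∀ μ : Fin (d + 1),
      |∑ x ∈ Λ, ∑ x' ∈ Λ', η ^ (2 * (d + 1)) *
          (ker321Z η μ G0 Gj g g' x x' * ⟪φ x, q (q (pd η⁻¹ μ φ' x' - pd η⁻¹ μ φ' x))⟫)| ≤ K * S := by
    intro μ
    calc |∑ x ∈ Λ, ∑ x' ∈ Λ', η ^ (2 * (d + 1)) *
            (ker321Z η μ G0 Gj g g' x x' * ⟪φ x, q (q (pd η⁻¹ μ φ' x' - pd η⁻¹ μ φ' x))⟫)|
        ≤ ∑ x ∈ Λ, |∑ x' ∈ Λ', η ^ (2 * (d + 1)) *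
            (ker321Z η μ G0 Gj g g' x x' * ⟪φ x, q (q (pd η⁻¹ μ φ' x' - pd η⁻¹ μ φ' x))⟫)| :=
          Finset.abs_sum_le_sum_abs _ _
      _ ≤ ∑ x ∈ Λ, ∑ x' ∈ Λ', |η ^ (2 * (d + 1)) *
            (ker321Z η μ G0 Gj g g' x x' * ⟪φ x, q (q (pd η⁻¹ μ φ' x' - pd η⁻¹ μ φ' x))⟫)| :=
          Finset.sum_le_sum fun x _ => Finset.abs_sum_le_sum_abs _ _
      _ ≤ ∑ x ∈ Λ, ∑ x' ∈ Λ', K * (η ^ (2 * (d + 1)) * (‖φ x‖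
            * (s ^ (1 - ((d + 1 : ℕ) : ℝ)) * Real.exp (-(δ / 2 * s⁻¹ * (η * dist₁ x x'))))
            * (s' ^ (2 - ((d + 1 : ℕ) : ℝ)) * Real.exp (-(δ / 2 * s'⁻¹ * (η * dist₁ x x')))))) :=
          Finset.sum_le_sum fun x _ => Finset.sum_le_sum fun x' _ => hterm μ x x'
      _ = K * S := by
          rw [hS, Finset.mul_sum]
          exact Finset.sum_congr rfl fun x _ => by rw [Finset.mul_sum]
  unfold rem322Z
  calc |∑ μ : Fin (d + 1), ∑ x ∈ Λ, ∑ x' ∈ Λ', η ^ (2 * (d + 1)) *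
          (ker321Z η μ G0 Gj g g' x x' * ⟪φ x, q (q (pd η⁻¹ μ φ' x' - pd η⁻¹ μ φ' x))⟫)|
      ≤ ∑ μ : Fin (d + 1), |∑ x ∈ Λ, ∑ x' ∈ Λ', η ^ (2 * (d + 1)) *
          (ker321Z η μ G0 Gj g g' x x' * ⟪φ x, q (q (pd η⁻¹ μ φ' x' - pd η⁻¹ μ φ' x))⟫)| :=
        Finset.abs_sum_le_sum_abs _ _
    _ ≤ ∑ _μ : Fin (d + 1), K * S := Finset.sum_le_sum fun μ _ => hslice μ
    _ = (d + 1 : ℕ) * (K * S) := by rw [Finset.sum_const, Finset.card_univ, Fintype.card_fin, nsmul_eq_mul]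
    _ = (d + 1 : ℕ) * C₁ * C₂ * Q ^ 2 * H * (1 + 2 / δ) * (min s s') ^ α * S := by rw [hK]; ring

end Bound

/-! ## §4 The zero-field infinite-lattice instance: the pieces `G^η_{(j)}(0)` of `G_k(0) = G_k(ηℤ^{d+1},0)` -/

section ZeroLattice

variable {ℓ k : ℕ} {a m2 : ℝ}

/-- kernel: `|x − x′|₁ ≤ (d+1)|x − x′|_∞`. [folklore] -/
private theorem dist₁_le_mul_supNorm (x x' : Fin (d + 1) → ℤ) :
    (dist₁ x x' : ℝ) ≤ ((d + 1 : ℕ) : ℝ) * supNorm (x - x') := by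
  have hterm : ∀ ν : Fin (d + 1), (((x ν - x' ν).natAbs : ℕ) : ℝ) ≤ supNorm (x - x') := by
    intro ν
    have h := abs_le_supNorm (x - x') ν
    rwa [Pi.sub_apply, ← Int.natCast_natAbs, Int.cast_natCast] at h
  unfold dist₁
  push_cast
  calc ∑ ν : Fin (d + 1), (((x ν - x' ν).natAbs : ℕ) : ℝ) ≤ ∑ _ν : Fin (d + 1), supNorm (x - x') :=
        Finset.sum_le_sum fun ν _ => hterm ν
    _ = ((d : ℝ) + 1) * supNorm (x - x') := by
        rw [Finset.sum_const, Finset.card_univ, Fintype.card_fin, nsmul_eq_mul]; push_cast; ring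

/-- **The (2.10) DERIVATIVE clause in the shape of the hypothesis `hG0` of `abs_rem322Z_le`**: from `Ineq210 δ₁ C` of the carrier
`zeroLatticeKernelsH` of the lattice pieces (`B3Ineq211ZeroLattice.ineq210_zeroLatticeH`; *"if the propagator is differentiated, then
for each differentiation, there is an additional factor (L^jη)^{−1}"*), for every rate `0 ≤ δ′ ≤ δ₁/(d+1)`, every `j`, axis `μ` and ALL
`x, x′`: `|(∂^η_μG^η_{(j)}(0))(x,x′)| ≤ C(L^jη)^{1−(d+1)}e^{−δ′(L^jη)^{−1}η|x−x′|₁}` (kernel `d1KernelZ η⁻¹ μ (gpieceZ j)`, `η = etaZ`).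
[cite: Balaban1983Higgs3, (2.10) p.426] -/
theorem abs_d1KernelZ_gpieceZ_le (hℓ : 1 ≤ ℓ) {δ₁ C : ℝ} (h210 : (zeroLatticeKernelsH d ℓ k hℓ a m2).Ineq210 δ₁ C)
    {δ' : ℝ} (hδ'0 : 0 ≤ δ') (hδ' : δ' ≤ δ₁ / ((d + 1 : ℕ) : ℝ)) (j : ℕ) (μ : Fin (d + 1)) (x x' : Fin (d + 1) → ℤ) :
    |d1KernelZ (etaZ ℓ k)⁻¹ μ (gpieceZ ℓ k j a m2) x x'| ≤ C * scaleZ ℓ k j ^ (1 - ((d + 1 : ℕ) : ℝ)) *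
      Real.exp (-(δ' * (scaleZ ℓ k j)⁻¹ * (etaZ ℓ k * dist₁ x x'))) := by
  have hLk : (0 : ℝ) < (((ℓ + 1) ^ k : ℕ) : ℝ) := by positivity
  have hs : 0 < scaleZ ℓ k j := scaleZ_pos ℓ k j
  have hη : 0 < etaZ ℓ k := etaZ_pos ℓ k
  have h := (h210 j x x').2 μ
  change ((((ℓ + 1) ^ k : ℕ) : ℝ)) ^ (d + 1) *
      (((((ℓ + 1) ^ k : ℕ) : ℝ)) * |pieceLat ℓ k j a m2 (x + Pi.single μ 1) x' - pieceLat ℓ k j a m2 x x'|) ≤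
    C * scaleZ ℓ k j ^ (1 - ((d + 1 : ℕ) : ℝ)) *
      Real.exp (-(δ₁ * (scaleZ ℓ k j)⁻¹ * (supNorm (x - x') / (((ℓ + 1) ^ k : ℕ) : ℝ)))) at h
  have hC : 0 ≤ C * scaleZ ℓ k j ^ (1 - ((d + 1 : ℕ) : ℝ)) :=
    nonneg_of_mul_nonneg_left (le_trans (by positivity) h) (Real.exp_pos _)
  have habs : |d1KernelZ (etaZ ℓ k)⁻¹ μ (gpieceZ ℓ k j a m2) x x'| = ((((ℓ + 1) ^ k : ℕ) : ℝ)) ^ (d + 1) *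
      (((((ℓ + 1) ^ k : ℕ) : ℝ)) * |pieceLat ℓ k j a m2 (x + Pi.single μ 1) x' - pieceLat ℓ k j a m2 x x'|) := by
    have e : d1KernelZ (etaZ ℓ k)⁻¹ μ (gpieceZ ℓ k j a m2) x x' = ((((ℓ + 1) ^ k : ℕ) : ℝ)) ^ (d + 1) *
        (((((ℓ + 1) ^ k : ℕ) : ℝ)) * (pieceLat ℓ k j a m2 (x + Pi.single μ 1) x' - pieceLat ℓ k j a m2 x x')) := by
      simp only [d1KernelZ, gpieceZ, etaZ, inv_inv]; ring
    rw [e, abs_mul, abs_of_nonneg (by positivity : (0:ℝ) ≤ ((((ℓ + 1) ^ k : ℕ) : ℝ)) ^ (d + 1)), abs_mul,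
      abs_of_nonneg (by positivity : (0:ℝ) ≤ (((ℓ + 1) ^ k : ℕ) : ℝ))]
  rw [habs]
  refine h.trans (mul_le_mul_of_nonneg_left ?_ hC)
  rw [Real.exp_le_exp, neg_le_neg_iff]
  have hd1 : (0 : ℝ) < ((d + 1 : ℕ) : ℝ) := by positivity
  have h1 : δ' * (dist₁ x x' : ℝ) ≤ δ₁ * supNorm (x - x') := by
    have hδ0 : 0 ≤ δ₁ / ((d + 1 : ℕ) : ℝ) := hδ'0.trans hδ'
    calc δ' * (dist₁ x x' : ℝ) ≤ (δ₁ / ((d + 1 : ℕ) : ℝ)) * (((d + 1 : ℕ) : ℝ) * supNorm (x - x')) :=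
          mul_le_mul hδ' (dist₁_le_mul_supNorm x x') (Nat.cast_nonneg _) hδ0
      _ = δ₁ * supNorm (x - x') := by field_simp
  have hc : 0 ≤ (scaleZ ℓ k j)⁻¹ * etaZ ℓ k := mul_nonneg (inv_nonneg.2 hs.le) hη.le
  calc δ' * (scaleZ ℓ k j)⁻¹ * (etaZ ℓ k * (dist₁ x x' : ℝ))
      = ((scaleZ ℓ k j)⁻¹ * etaZ ℓ k) * (δ' * (dist₁ x x' : ℝ)) := by ring
    _ ≤ ((scaleZ ℓ k j)⁻¹ * etaZ ℓ k) * (δ₁ * supNorm (x - x')) := mul_le_mul_of_nonneg_left h1 hc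
    _ = δ₁ * (scaleZ ℓ k j)⁻¹ * (supNorm (x - x') / (((ℓ + 1) ^ k : ℕ) : ℝ)) := by unfold etaZ; ring

/-- **(3.22) → (3.23) FOR THE PIECES OF `G_k(0)` ON `ηℤ^{d+1}`** (*"we sum over proper orderings and j-indices and we get (3.23)"* with
the multiscale decomposition (2.6) of the print's propagator): for `1 ≤ n ≤ k`, the second graph of (3.21) with BOTH lines the pieces
`G^η_{(j)}(0)`, `G^η_{(j′)}(0)` summed over `j, j′ < n` equals the sum of the generalized graphs `rem322Z[j,j′]` plus EXACTLY (3.23) on the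
resummed propagator `𝒢_n = Σ_{j<n}G^η_{(j)}(0)` in both slots (`GresumZ n`; `n = k` is `G_k(0)` itself, `B3Ineq314ZeroLattice.GresumZ_top`).
[cite: Balaban1983Higgs3, (3.22)–(3.23) p.439, (2.6) p.424] -/
theorem sum_expr321bZ_eq_zeroLattice {W : Type*} [NormedAddCommGroup W] [InnerProductSpace ℝ W] {n : ℕ} (hn : 1 ≤ n)
    (hnk : n ≤ k) (q : W →ₗ[ℝ] W) (g g' : (Fin (d + 1) → ℤ) → ℝ) (φ φ' : (Fin (d + 1) → ℤ) → W)
    (Λ Λ' : Finset (Fin (d + 1) → ℤ)) :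
    ∑ j ∈ Finset.range n, ∑ j' ∈ Finset.range n,
        expr321bZ (etaZ ℓ k) q (gpieceZ ℓ k j a m2) (gpieceZ ℓ k j' a m2) g g' φ φ' Λ Λ' =
      (∑ j ∈ Finset.range n, ∑ j' ∈ Finset.range n,
          rem322Z (etaZ ℓ k) q (gpieceZ ℓ k j a m2) (gpieceZ ℓ k j' a m2) g g' φ φ' Λ Λ') +
        expr323Z (etaZ ℓ k) q (GresumZ ℓ k n a m2) (GresumZ ℓ k n a m2) g g' φ φ' Λ Λ' := by
  rw [sum_expr321bZ_eq, sum_gpieceZ_range hn hnk]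

/-- **"The first graph on the right side has positive degree" WITH THE KERNEL HYPOTHESES DISCHARGED for the pieces of the print's §3
propagator `G_k(0) = G_k(ηℤ^{d+1}, 0)`.**  For `d`, `L = ℓ + 1 ≥ 2` and a window `[a₋,a₊] × [0,m²₊]` (`a₋ > 0`) there are `δ, C > 0` such
that for EVERY scale `k ≥ 1`, every window point, all pairs of piece indices `j, j′` (both lines = the zero-field scalar pieces
`G^η_{(j)}(0)`, `G^η_{(j′)}(0)`; no piece above `k`), every charge matrix with `‖qw‖ ≤ Q‖w‖`, all `|g|,|g′| ≤ 1`, every `φ`, every leg `φ′`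
with `HolderDeriv η⁻¹ α H φ′` (`0 ≤ α ≤ 1`) and all finite localization sets:
`|rem322Z[G^η_{(j)}(0), G^η_{(j′)}(0)]| ≤ (d+1)C²Q²H(1 + 2/δ)·(min(L^jη,L^{j′}η))^α·Σ_{x,x′}η^{2(d+1)}‖φ(x)‖(L^jη)^{1−(d+1)}e^{−½δ|x−x′|/L^jη}
(L^{j′}η)^{2−(d+1)}e^{−½δ|x−x′|/L^{j′}η}` (`|x − x′| = η|x − x′|₁`) — the (2.10) inputs are p26 g34's lattice pieces
(`B3Ineq211ZeroLattice.ineq210_zeroLatticeH`, value and derivative clauses), at the rate `δ = δ₁/(d+1)`.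
[cite: Balaban1983Higgs3, (3.22) p.439, (2.10) p.426] -/
theorem abs_rem322Z_le_zeroLattice (d ℓ : ℕ) (hℓ : 1 ≤ ℓ) (amin aplus m2plus : ℝ) (ha : 0 < amin)
    {W : Type*} [NormedAddCommGroup W] [InnerProductSpace ℝ W] :
    ∃ δ C : ℝ, 0 < δ ∧ 0 < C ∧ ∀ (k : ℕ), 1 ≤ k → ∀ (a m2 : ℝ), amin ≤ a → a ≤ aplus → 0 ≤ m2 → m2 ≤ m2plus →
      ∀ (j j' : ℕ) {α H Q : ℝ}, 0 ≤ α → α ≤ 1 → 0 ≤ H → 0 ≤ Q →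
      ∀ (q : W →ₗ[ℝ] W), (∀ w : W, ‖q w‖ ≤ Q * ‖w‖) →
      ∀ (g g' : (Fin (d + 1) → ℤ) → ℝ), (∀ x, |g x| ≤ 1) → (∀ x, |g' x| ≤ 1) →
      ∀ (φ φ' : (Fin (d + 1) → ℤ) → W), HolderDeriv (etaZ ℓ k)⁻¹ α H φ' →
      ∀ (Λ Λ' : Finset (Fin (d + 1) → ℤ)),
        |rem322Z (etaZ ℓ k) q (gpieceZ ℓ k j a m2) (gpieceZ ℓ k j' a m2) g g' φ φ' Λ Λ'| ≤
          (d + 1 : ℕ) * C * C * Q ^ 2 * H * (1 + 2 / δ) * (min (scaleZ ℓ k j) (scaleZ ℓ k j')) ^ α *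
            ∑ x ∈ Λ, ∑ x' ∈ Λ', etaZ ℓ k ^ (2 * (d + 1)) *
              (‖φ x‖ * (scaleZ ℓ k j ^ (1 - ((d + 1 : ℕ) : ℝ)) *
                  Real.exp (-(δ / 2 * (scaleZ ℓ k j)⁻¹ * (etaZ ℓ k * dist₁ x x'))))
                * (scaleZ ℓ k j' ^ (2 - ((d + 1 : ℕ) : ℝ)) *
                  Real.exp (-(δ / 2 * (scaleZ ℓ k j')⁻¹ * (etaZ ℓ k * dist₁ x x'))))) := by
  obtain ⟨δ₁, C, hδ₁, hC, h210⟩ := ineq210_zeroLatticeH d ℓ hℓ amin aplus m2plus ha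
  have hd1 : (0 : ℝ) < ((d + 1 : ℕ) : ℝ) := by positivity
  refine ⟨δ₁ / ((d + 1 : ℕ) : ℝ), C, div_pos hδ₁ hd1, hC, ?_⟩
  intro k hk a m2 h1 h2 h3 h4 j j' α H Q hα0 hα1 hH hQ q hq g g' hg hg' φ φ' hφ' Λ Λ'
  have h210k := h210 k hk a m2 h1 h2 h3 h4
  have hδ'0 : 0 ≤ δ₁ / ((d + 1 : ℕ) : ℝ) := (div_pos hδ₁ hd1).le
  exact abs_rem322Z_le (etaZ ℓ k) (etaZ_pos ℓ k) hα0 hα1 hH hQ (div_pos hδ₁ hd1) (scaleZ_pos ℓ k j) (scaleZ_pos ℓ k j')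
    q hq _ _ g g' hg hg' (fun μ x x' => abs_d1KernelZ_gpieceZ_le hℓ h210k hδ'0 le_rfl j μ x x')
    (fun x x' => abs_gpieceZ_le hℓ h210k hδ'0 le_rfl j' x x') φ φ' hφ' Λ Λ'

end ZeroLattice

end

end Literature.MathematicalPhysics.QuantumFieldTheory.Balaban1983to89.B3Eq322ZeroLattice
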